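import Summits.CriticalPhenomena.PercolationContinuityZ3.Theorems.Transplant.BoxProdZ2ConcFaceRoute
import Summits.CriticalPhenomena.PercolationContinuityZ3.Theorems.Transplant.BoxProdZ2ConcFaceReal
import Summits.CriticalPhenomena.PercolationContinuityZ3.Theorems.Transplant.KNCells2KitResiduesRun
import HarnessLib

/-!
# RESIDUE (F) DISCHARGED: the face obligations `FaceOblC` / `FaceOblR` of the concentric `X □ ℤ²` instance at the schedule
# `concRadiiGB C gap gap' E₀ L'` with the elongated deep routes PROVED (`route_of_contact`, KN Lemma 11 in the product) — hypotheses are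
# constants / inequalities and inputs at the running parameter only (design (D), §11 v2; lead 16:02Z (a))

builds on p205010 (kernel theorem, internal audit signed; external expert review pending) — nothing in this file uses p205010.
Lane `prim-bschramm`, seat `prim-bschramm-p3` (residue (F) of V56); helper file (`--supports stmt-CriticalPhenomena-4575 --as helper`).

* `chain_of_le` — the chain property (shape of `chain_edge_tube_UP` / stmt-g6's `δUP_spec`) at accuracy `δ'` gives it at every `δ ≤ δ'`
  (`KitsAt.mono`), so ONE inner accuracy `δA ≤ δUP n` serves every chain length `n ≤ nmax`;
* **`hroute_concGB`** — the hypothesis `hroute` of `faceOblC_concGB` from the inner-route inputs;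
* **`faceOblC_concGB'`**, **`faceOblR_concGB`** — `KSchA.FaceOblC` / `KSchA.FaceOblR` for `concSchemeG X C w₀ (concRadiiGB C gap gap' E₀ L') q δc`
  with NO route hypothesis.
[cite: KozmaNitzan2024, §4 p. 30 (Step III), Lemma 10 (p. 17), Lemma 11 (pp. 22–23), Lemma 12 (p. 24)]
-/

noncomputable section

open MeasureTheory

namespace Summit.CriticalPhenomena.PercolationContinuityZ3.Theorems

namespace Transplant

namespace BoxProdZ2

open Literature.Probability.Percolation Literature.Probability.LatticeModels SimpleGraph KNLevels KNCells GadgetSystem Contour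
open Literature.Probability.Percolation.KozmaNitzan
open Literature.Probability.Percolation.KozmaNitzan.Cells (oth oth_ne sgOf sgOf_sign eq_oth_of_ne)
open Literature.Probability.Percolation.GM
open Literature.Barriers.CriticalPhenomena (graphBall graphBall_finite mem_graphBall_self graphBall_mono)
open scoped Classical

variable {W : Type} [DecidableEq W] [Countable W] (X : SimpleGraph W) [X.LocallyFinite]

/-! ## §1 One accuracy for all chain lengths -/

omit [Countable W] in
/-- **The chain property is monotone in the accuracy**: if it holds at `δ'` (kits at `δ'`, excess `≤ δ'/2`, source `> 1 - δ'`), it holds at every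
`δ ≤ δ'` (`TStep.KitsAt.mono`). [folklore] -/
theorem chain_of_le {q : unitInterval} {Δ' n : ℕ} {δ δ' ε : ℝ} (hδδ' : δ ≤ δ') {π : Finset W}
    (h : ∀ (Wg : Sym2 (W × Site 2) → unitInterval) (s : Fin (n + 1) → TStep (tubeGraph X π)) (T' : Fin (n + 1) → Finset (W × Site 2)) (η : ℝ),
      (∀ i, (s i).L.o = (s 0).L.o) → (∀ i : Fin n, T' (Fin.castSucc i) ⊆ (s i.succ).L.X 0) → (∀ i, T' i ⊆ (s i).T) →
      (∀ i, (s i).KitsAt Wg q Δ' δ') → η ≤ δ' / 2 →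
      (∀ i, (prodBernoulli Wg).real (⋃ t ∈ (s i).T \ T' i, openConn (s 0).L.o t) ≤ η) →
      1 - δ' < (prodBernoulli Wg).real (s 0).L.reachB → 1 - ε < (prodBernoulli Wg).real (⋃ t ∈ T' (Fin.last n), openConn (s 0).L.o t)) :
    ∀ (Wg : Sym2 (W × Site 2) → unitInterval) (s : Fin (n + 1) → TStep (tubeGraph X π)) (T' : Fin (n + 1) → Finset (W × Site 2)) (η : ℝ),
      (∀ i, (s i).L.o = (s 0).L.o) → (∀ i : Fin n, T' (Fin.castSucc i) ⊆ (s i.succ).L.X 0) → (∀ i, T' i ⊆ (s i).T) →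
      (∀ i, (s i).KitsAt Wg q Δ' δ) → η ≤ δ / 2 →
      (∀ i, (prodBernoulli Wg).real (⋃ t ∈ (s i).T \ T' i, openConn (s 0).L.o t) ≤ η) →
      1 - δ < (prodBernoulli Wg).real (s 0).L.reachB → 1 - ε < (prodBernoulli Wg).real (⋃ t ∈ T' (Fin.last n), openConn (s 0).L.o t) :=
  fun Wg s T' η ho hlink hT hk hη hexc hsrc =>
    h Wg s T' η ho hlink hT (fun i => (hk i).mono hδδ') (hη.trans (by linarith)) hexc (lt_of_le_of_lt (by linarith) hsrc)

/-! ## §2 The deep routes of the face step -/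

/-- **The hypothesis `hroute` of `faceOblC_concGB`, DISCHARGED** by `route_of_contact`: for every chosen valid `(h, e)`, onward `du`, `j < K`,
`o`, every level `j' ∈ [M+1, Rlev]` of the face step and every deep contact, the elongated route exists.  Inputs (inner, all at the running
parameter `q`): inputs at accuracy `δA²` (kit scale `M`, route scales `[ℓ₀, ℓ₁A]`), frames, the chain property at `(Δ', δA ↦ δ₂²)` for every
length `≤ nmax + 1`, inner counts at `δA`, an inner excess radius `R₁A ≤ L_A - L'_A` (entrances within `R₀A ≥ ψ M`, box `25 r`, `ηA ≤ δA/2`),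
and the constants: `ψ ℓ₁A + ψ M ≤ L'_A ≤ L_A`, `RlevA + 1 ≤ R'_A`, `R'_A + ℓ₀ ≤ s₁`, `2 R'_A ≤ s₁`, `M + s₁ + 2R'_A + 1 ≤ ℓ1 ≤ ℓ₁A`, `s₁ + R'_A ≤ ℓ₁A`,
`12 r ≤ nmax · s₁`, `Rlev + ℓ1 + 2 s₁ + (nmax + 3) R'_A ≤ r`, `Rlev + ℓ1 + 1 ≤ 10 s`.
[cite: KozmaNitzan2024, §4 p. 30 (Step III), Lemma 11 (pp. 22–23), Lemma 12 (p. 24)] -/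
theorem hroute_concGB (C : PCells) (w₀ : W) (gap gap' : ℕ → ℕ) (E₀ L' : ℕ) {q : unitInterval} {δc : ℝ}
    {Δ Δ' : ℕ} (hΔ : ∀ w, X.degree w ≤ Δ) {p₀ : unitInterval} (hT : TubeSubcritical X p₀) (V₀ : Finset W)
    (hfr : ∀ w : W, ∃ γ : X ≃g X, γ w ∈ V₀) {δ₂ δA : ℝ} (hδA : 0 < δA) (hδA1 : δA ≤ 1) {msel : W → ℕ} {M : ℕ}
    (hmsel : ∀ τ ∈ V₀, msel τ ≤ M)
    (hstdA : ∀ τ ∈ V₀,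
      1 - δA ^ 2 < (bondPercolation (X □ zdGraph 2) q).real (UniqZone.zone (X □ zdGraph 2) (ufatSeq X hT V₀ τ) (msel τ) M) ∧
      ∀ g : HOct 2, 1 - δA ^ 2 < (bondPercolation (X □ zdGraph 2) q).real
        (linkIn (↑(ufatSeq X hT V₀ τ M)) (ufatSeq X hT V₀ τ (msel τ)) (ballFin X τ (ufatRadius X hT V₀ M) ×ˢ piece g M)))
    {ℓ₀ ℓ₁A : ℕ} (hMℓ : M < ℓ₀)
    (hlinkA : ∀ ℓ, ℓ₀ ≤ ℓ → ℓ ≤ ℓ₁A → ∀ τ ∈ V₀, ∀ g : HOct 2, 1 - δA ^ 2 < (bondPercolation (X □ zdGraph 2) q).real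
      (linkIn (↑(ufatSeq X hT V₀ τ ℓ)) (ufatSeq X hT V₀ τ (msel τ)) (ballFin X τ (ufatRadius X hT V₀ ℓ) ×ˢ piece g ℓ)))
    {nmax : ℕ}
    (hchainA : ∀ n, n ≤ nmax → ∀ (π : Finset W) (Wg : Sym2 (W × Site 2) → unitInterval) (s : Fin (n + 1) → TStep (tubeGraph X π))
      (T' : Fin (n + 1) → Finset (W × Site 2)) (η : ℝ),
      (∀ i, (s i).L.o = (s 0).L.o) → (∀ i : Fin n, T' (Fin.castSucc i) ⊆ (s i.succ).L.X 0) → (∀ i, T' i ⊆ (s i).T) →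
      (∀ i, (s i).KitsAt Wg q Δ' δA) → η ≤ δA / 2 →
      (∀ i, (prodBernoulli Wg).real (⋃ t ∈ (s i).T \ T' i, openConn (s 0).L.o t) ≤ η) →
      1 - δA < (prodBernoulli Wg).real (s 0).L.reachB →
        1 - δ₂ ^ 2 < (prodBernoulli Wg).real (⋃ t ∈ T' (Fin.last n), openConn (s 0).L.o t))
    {L_A L'A s₁ R'A RlevA kkA N_A ℓ1 Rlev N : ℕ}
    (hLψA : ufatRadius X hT V₀ ℓ₁A + ufatRadius X hT V₀ M ≤ L'A) (hLRA : L'A ≤ L_A) (hRlA : RlevA + 1 ≤ R'A)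
    (hs : R'A + ℓ₀ ≤ s₁) (hs2 : 2 * R'A ≤ s₁) (hℓ1 : M + s₁ + 2 * R'A + 1 ≤ ℓ1) (hℓ1A : ℓ1 ≤ ℓ₁A) (hsA : s₁ + R'A ≤ ℓ₁A)
    (hn : 12 * C.r ≤ nmax * s₁) (hbig : Rlev + ℓ1 + 2 * s₁ + (nmax + 3) * R'A ≤ C.r) (h10s : Rlev + ℓ1 + 1 ≤ 10 * C.s)
    (hNA : kkA * kitB Δ M (ufatRadius X hT V₀ M) ≤ N_A) (hkkA : (1 - (q : ℝ) ^ kitSB Δ M (ufatRadius X hT V₀ M)) ^ kkA ≤ δA)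
    (hcountA : 1 / (1 - (q : ℝ)) ^ (Δ' * N_A) ≤ δA * ((Finset.Icc (M + 1) RlevA).card : ℝ))
    {ηA : ℝ} (hηA : ηA ≤ δA / 2) {R₀A R₁A : ℕ} (hR₀A : ufatRadius X hT V₀ M ≤ R₀A)
    (hR₁A : ∀ R'', R₁A ≤ R'' → ∀ τ ∈ V₀, ∀ (Rw : ℕ) (D' A' : Finset (W × Site 2)), D' ⊆ ballFin X τ Rw ×ˢ box 2 (25 * C.r) → A' ⊆ D' →
      (∀ a ∈ A', a.1 ∈ ballFin X τ R₀A) → (bondPercolation (X □ zdGraph 2) q).real (excess X τ R'' D' A') ≤ ηA)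
    (hR₁LA : R₁A ≤ L_A - L'A) :
    ∀ (h : ProbeHistory (W × Site 2)) (e : Site 2 × MDir),
      ((concSchemeG X C w₀ (concRadiiGB C gap gap' E₀ L') q δc).astOf₂ (X □ zdGraph 2) h).st.choice = some e →
      (concSchemeG X C w₀ (concRadiiGB C gap gap' E₀ L') q δc).Valid₂ (X □ zdGraph 2) h e →
      ∀ du ∈ (concSchemeG X C w₀ (concRadiiGB C gap gap' E₀ L') q δc).onward (X □ zdGraph 2) h (tgt e), ∀ j < C.K,
      ∀ (o : Finset (Sym2 (W × Site 2))),
      let Λ := concRadiiGB C gap gap' E₀ L'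
      let S := concSchemeG X C w₀ Λ q δc
      let a := S.aOf₁ (X □ zdGraph 2) h e
      let a' := S.aOf₂ (X □ zdGraph 2) h e
      let P := faceStep X C w₀ Λ a' (tgt e) du j Rlev N M L' (S.Sx (X □ zdGraph 2) h e a a' du)
      ∀ j', M + 1 ≤ j' → j' ≤ Rlev → ∀ x' ∈ outerBoundary (tubeGraph X P.π) (tubeLevel P.π P.lo P.hi j'),
        ballFin X (fibCtrT X w₀ (Λ.rE a' (tgt e) du) (ufatRadius X hT V₀ M) x'.1) L_A ⊆ ballFin X w₀ (Λ.rM a' (tgt e + stepVec du)) →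
        ∃ (γ : X ≃g X) (Qt Ft : Finset (W × Site 2)), γ (fibCtrT X w₀ (Λ.rE a' (tgt e) du) (ufatRadius X hT V₀ M) x'.1) ∈ V₀ ∧
          Ft ⊆ P.T ∧ Qt ⊆ P.Rg ∧
          Disjoint Ft (kitCube X w₀ (Λ.rE a' (tgt e) du) (P.lo - ((j' : ℕ) : Site 2)) (P.hi + ((j' : ℕ) : Site 2)) M (ufatRadius X hT V₀ M) x') ∧
          1 - δ₂ ^ 2 < (prodBernoulli (S.Wt (X □ zdGraph 2) h e a a' du j o)).real (linkIn (↑Qt)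
            (frameSeq X hT V₀ γ (vctr (P.lo - ((j' : ℕ) : Site 2)) (P.hi + ((j' : ℕ) : Site 2)) M
              (pwin (P.lo - ((j' : ℕ) : Site 2)) (P.hi + ((j' : ℕ) : Site 2)) M x'.2).1
              (pwin (P.lo - ((j' : ℕ) : Site 2)) (P.hi + ((j' : ℕ) : Site 2)) M x'.2).2.1
              (pwin (P.lo - ((j' : ℕ) : Site 2)) (P.hi + ((j' : ℕ) : Site 2)) M x'.2).2.2)
              (γ (fibCtrT X w₀ (Λ.rE a' (tgt e) du) (ufatRadius X hT V₀ M) x'.1))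
              (msel (γ (fibCtrT X w₀ (Λ.rE a' (tgt e) du) (ufatRadius X hT V₀ M) x'.1)))) Ft) := by
  intro h e _ hV du hdu j hj o Λ S a a' P j' hj'0 hj'1 x' hx' hdeep
  have hΛ : Λ.WF C := concRadiiGB_WF C gap gap' E₀ L'
  have hjK : j + 1 ≤ C.K := hj
  have hRt : Λ.rM a' (tgt e + stepVec du) ≤ Λ.rE a' (tgt e) du := hΛ.ME a' (tgt e) du
  have hWsub : ∀ Dd, Dd ⊆ ballFin X w₀ (Λ.rE a' (tgt e) du) ×ˢ C.farA (tgt e) du j →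
      IsSubbox (tubeGraph X (ballFin X w₀ (Λ.rE a' (tgt e) du))) (S.Wt (X □ zdGraph 2) h e a a' du j o) q Dd := fun Dd hDd =>
    isSubbox_Wt_face X hΛ hV hdu (hDd.trans (Finset.product_subset_product le_rfl (C.farA_subset_Efar _ du j)))
      ((prod_disjoint_Stub X C w₀ Λ (C.farA_disjoint_Stub (tgt e) du j)).mono_left hDd)
  have hWG : ∀ e', e' ∉ (X □ zdGraph 2).edgeSet → S.Wt (X □ zdGraph 2) h e a a' du j o e' = 0 := fun e' he' =>
    Wt_eq_zero_of_not_mem_edgeSet X he'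
  have hR₁' : ∀ R'', R₁A ≤ R'' → ∀ τ ∈ V₀, ∀ (Rw : ℕ) (D' A' : Finset (W × Site 2)), D' ⊆ ballFin X τ Rw ×ˢ box 2 (25 * C.r) →
      A' ⊆ D' → (∀ a ∈ A', a.1 ∈ ballFin X τ (ufatRadius X hT V₀ M)) →
      (bondPercolation (X □ zdGraph 2) q).real (excess X τ R'' D' A') ≤ ηA :=
    fun R'' hR'' τ hτ Rw D' A' hD' hA' hA => hR₁A R'' hR'' τ hτ Rw D' A' hD' hA' fun a ha => ballFin_mono X τ hR₀A (hA a ha)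
  obtain ⟨γ, Qt, Ft, hγ, hFt, hQt, hdisj, hlt⟩ := route_of_contact X C hjK hRt hWsub hWG hΔ hT V₀ hfr hδA hδA1 hmsel hstdA hMℓ hlinkA
    hchainA hLψA hLRA hRlA hs hs2 hℓ1 hℓ1A hsA hn hbig h10s (N_A := N_A) hNA hkkA hcountA hηA hR₁' hR₁LA hj'0 hj'1 hx' hdeep
  exact ⟨γ, Qt, Ft, hγ, hFt.trans Finset.subset_union_left, hQt, hdisj, hlt⟩

/-! ## §3 The face obligations with the routes discharged -/

/-- **`FaceOblC` for the concentric instance at the schedule `concRadiiGB`, routes discharged** (chosen-edge form): `faceOblC_concGB` with its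
hypothesis `hroute` supplied by `hroute_concGB`.  Hypotheses: the outer kit machinery at `q` (accuracy `δ₂²`, scale `M`, counts, `ψ M ≤ E₀`,
`L_A + ψ M ≤ L'`, levels `[M+1, Rlev]`, `R₁`, `2 L' + R₁ ρ ≤ gap ρ`) and the inner-route inputs of `hroute_concGB`.
[cite: KozmaNitzan2024, §4 p. 30 (Step III), Lemma 10 (p. 17), Lemma 11 (pp. 22–23), Lemma 12 (p. 24)] -/
theorem faceOblC_concGB' (C : PCells) (w₀ : W) (gap gap' : ℕ → ℕ) (E₀ L' : ℕ) {q : unitInterval} {δc : ℝ}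
    {Δ Δ' : ℕ} (hΔ : ∀ w, X.degree w ≤ Δ) {p₀ : unitInterval} (hT : TubeSubcritical X p₀) (V₀ : Finset W)
    (hfr : ∀ w : W, ∃ γ : X ≃g X, γ w ∈ V₀) {δ₂ : ℝ} (hδ₂ : 0 < δ₂)
    {msel : W → ℕ} {M : ℕ} (hmsel : ∀ τ ∈ V₀, msel τ ≤ M)
    (hstd : ∀ τ ∈ V₀,
      1 - δ₂ ^ 2 < (bondPercolation (X □ zdGraph 2) q).real (UniqZone.zone (X □ zdGraph 2) (ufatSeq X hT V₀ τ) (msel τ) M) ∧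
      ∀ g : HOct 2, 1 - δ₂ ^ 2 < (bondPercolation (X □ zdGraph 2) q).real
        (linkIn (↑(ufatSeq X hT V₀ τ M)) (ufatSeq X hT V₀ τ (msel τ)) (ballFin X τ (ufatRadius X hT V₀ M) ×ˢ piece g M)))
    {L_A Rlev kk N : ℕ} (hψ : ufatRadius X hT V₀ M ≤ E₀) (hL : L_A + ufatRadius X hT V₀ M ≤ L') (hMR : M + 1 ≤ Rlev)
    (hRlev : Rlev + 3 ≤ 10 * C.s) (hRlev' : Rlev + 1 ≤ 3 * C.r)
    (hN : kk * kitB Δ M (ufatRadius X hT V₀ M) ≤ N) (hk : (1 - (q : ℝ) ^ kitSB Δ M (ufatRadius X hT V₀ M)) ^ kk ≤ δ₂)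
    (hcount : 1 / (1 - (q : ℝ)) ^ (Δ' * N) ≤ δ₂ * ((Finset.Icc (M + 1) Rlev).card : ℝ))
    {η : ℝ} (hη : η ≤ δc / 2) (R₁ : ℕ → ℕ)
    (hR₁ : ∀ ρ R', R₁ ρ ≤ R' → ∀ τ ∈ ({w₀} : Finset W), ∀ (Rw : ℕ) (D' A' : Finset (W × Site 2)), D' ⊆ ballFin X τ Rw ×ˢ box 2 (25 * C.r) →
      A' ⊆ D' → (∀ v ∈ A', v.1 ∈ ballFin X τ (ρ + 1)) → (bondPercolation (X □ zdGraph 2) q).real (excess X τ R' D' A') ≤ η)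
    (hgap : ∀ ρ, 2 * L' + R₁ ρ ≤ gap ρ)
    -- the inner-route inputs
    {δA : ℝ} (hδA : 0 < δA) (hδA1 : δA ≤ 1)
    (hstdA : ∀ τ ∈ V₀,
      1 - δA ^ 2 < (bondPercolation (X □ zdGraph 2) q).real (UniqZone.zone (X □ zdGraph 2) (ufatSeq X hT V₀ τ) (msel τ) M) ∧
      ∀ g : HOct 2, 1 - δA ^ 2 < (bondPercolation (X □ zdGraph 2) q).real
        (linkIn (↑(ufatSeq X hT V₀ τ M)) (ufatSeq X hT V₀ τ (msel τ)) (ballFin X τ (ufatRadius X hT V₀ M) ×ˢ piece g M)))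
    {ℓ₀ ℓ₁A : ℕ} (hMℓ : M < ℓ₀)
    (hlinkA : ∀ ℓ, ℓ₀ ≤ ℓ → ℓ ≤ ℓ₁A → ∀ τ ∈ V₀, ∀ g : HOct 2, 1 - δA ^ 2 < (bondPercolation (X □ zdGraph 2) q).real
      (linkIn (↑(ufatSeq X hT V₀ τ ℓ)) (ufatSeq X hT V₀ τ (msel τ)) (ballFin X τ (ufatRadius X hT V₀ ℓ) ×ˢ piece g ℓ)))
    {nmax : ℕ}
    (hchainA : ∀ n, n ≤ nmax → ∀ (π : Finset W) (Wg : Sym2 (W × Site 2) → unitInterval) (s : Fin (n + 1) → TStep (tubeGraph X π))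
      (T' : Fin (n + 1) → Finset (W × Site 2)) (η : ℝ),
      (∀ i, (s i).L.o = (s 0).L.o) → (∀ i : Fin n, T' (Fin.castSucc i) ⊆ (s i.succ).L.X 0) → (∀ i, T' i ⊆ (s i).T) →
      (∀ i, (s i).KitsAt Wg q Δ' δA) → η ≤ δA / 2 →
      (∀ i, (prodBernoulli Wg).real (⋃ t ∈ (s i).T \ T' i, openConn (s 0).L.o t) ≤ η) →
      1 - δA < (prodBernoulli Wg).real (s 0).L.reachB →
        1 - δ₂ ^ 2 < (prodBernoulli Wg).real (⋃ t ∈ T' (Fin.last n), openConn (s 0).L.o t))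
    {L'A s₁ R'A RlevA kkA N_A ℓ1 : ℕ}
    (hLψA : ufatRadius X hT V₀ ℓ₁A + ufatRadius X hT V₀ M ≤ L'A) (hLRA : L'A ≤ L_A) (hRlA : RlevA + 1 ≤ R'A)
    (hs : R'A + ℓ₀ ≤ s₁) (hs2 : 2 * R'A ≤ s₁) (hℓ1 : M + s₁ + 2 * R'A + 1 ≤ ℓ1) (hℓ1A : ℓ1 ≤ ℓ₁A) (hsA : s₁ + R'A ≤ ℓ₁A)
    (hn : 12 * C.r ≤ nmax * s₁) (hbig : Rlev + ℓ1 + 2 * s₁ + (nmax + 3) * R'A ≤ C.r) (h10s : Rlev + ℓ1 + 1 ≤ 10 * C.s)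
    (hNA : kkA * kitB Δ M (ufatRadius X hT V₀ M) ≤ N_A) (hkkA : (1 - (q : ℝ) ^ kitSB Δ M (ufatRadius X hT V₀ M)) ^ kkA ≤ δA)
    (hcountA : 1 / (1 - (q : ℝ)) ^ (Δ' * N_A) ≤ δA * ((Finset.Icc (M + 1) RlevA).card : ℝ))
    {ηA : ℝ} (hηA : ηA ≤ δA / 2) {R₀A R₁A : ℕ} (hR₀A : ufatRadius X hT V₀ M ≤ R₀A)
    (hR₁A : ∀ R'', R₁A ≤ R'' → ∀ τ ∈ V₀, ∀ (Rw : ℕ) (D' A' : Finset (W × Site 2)), D' ⊆ ballFin X τ Rw ×ˢ box 2 (25 * C.r) → A' ⊆ D' →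
      (∀ a ∈ A', a.1 ∈ ballFin X τ R₀A) → (bondPercolation (X □ zdGraph 2) q).real (excess X τ R'' D' A') ≤ ηA)
    (hR₁LA : R₁A ≤ L_A - L'A) :
    KSchA.FaceOblC X (concSchemeG X C w₀ (concRadiiGB C gap gap' E₀ L') q δc) (faceDataCG X C w₀ (concRadiiGB C gap gap' E₀ L')) Δ' δ₂ :=
  faceOblC_concGB X C w₀ gap gap' E₀ L' hΔ hT V₀ hδ₂ hmsel hstd hψ hL hMR hRlev hRlev' hN hk hcount hη R₁ hR₁ hgap
    (hroute_concGB X C w₀ gap gap' E₀ L' hΔ hT V₀ hfr hδA hδA1 hmsel hstdA hMℓ hlinkA hchainA hLψA hLRA hRlA hs hs2 hℓ1 hℓ1A hsA hn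
      hbig h10s hNA hkkA hcountA hηA hR₀A hR₁A hR₁LA)

/-- **`FaceOblR` for the concentric instance at the schedule `concRadiiGB`, routes discharged** (run form, what `FaceHoldsRFn` /
`thetaDropBoxProdZ2_of_choiceFnR` consume): `faceOblR_of_faceOblC ∘ faceOblC_concGB'`. [cite: KozmaNitzan2024, §4 p. 30 (Steps III–IV)] -/
theorem faceOblR_concGB (C : PCells) (w₀ : W) (gap gap' : ℕ → ℕ) (E₀ L' : ℕ) {q : unitInterval} {δc : ℝ}
    {Δ Δ' : ℕ} (hΔ : ∀ w, X.degree w ≤ Δ) {p₀ : unitInterval} (hT : TubeSubcritical X p₀) (V₀ : Finset W)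
    (hfr : ∀ w : W, ∃ γ : X ≃g X, γ w ∈ V₀) {δ₂ : ℝ} (hδ₂ : 0 < δ₂)
    {msel : W → ℕ} {M : ℕ} (hmsel : ∀ τ ∈ V₀, msel τ ≤ M)
    (hstd : ∀ τ ∈ V₀,
      1 - δ₂ ^ 2 < (bondPercolation (X □ zdGraph 2) q).real (UniqZone.zone (X □ zdGraph 2) (ufatSeq X hT V₀ τ) (msel τ) M) ∧
      ∀ g : HOct 2, 1 - δ₂ ^ 2 < (bondPercolation (X □ zdGraph 2) q).real
        (linkIn (↑(ufatSeq X hT V₀ τ M)) (ufatSeq X hT V₀ τ (msel τ)) (ballFin X τ (ufatRadius X hT V₀ M) ×ˢ piece g M)))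
    {L_A Rlev kk N : ℕ} (hψ : ufatRadius X hT V₀ M ≤ E₀) (hL : L_A + ufatRadius X hT V₀ M ≤ L') (hMR : M + 1 ≤ Rlev)
    (hRlev : Rlev + 3 ≤ 10 * C.s) (hRlev' : Rlev + 1 ≤ 3 * C.r)
    (hN : kk * kitB Δ M (ufatRadius X hT V₀ M) ≤ N) (hk : (1 - (q : ℝ) ^ kitSB Δ M (ufatRadius X hT V₀ M)) ^ kk ≤ δ₂)
    (hcount : 1 / (1 - (q : ℝ)) ^ (Δ' * N) ≤ δ₂ * ((Finset.Icc (M + 1) Rlev).card : ℝ))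
    {η : ℝ} (hη : η ≤ δc / 2) (R₁ : ℕ → ℕ)
    (hR₁ : ∀ ρ R', R₁ ρ ≤ R' → ∀ τ ∈ ({w₀} : Finset W), ∀ (Rw : ℕ) (D' A' : Finset (W × Site 2)), D' ⊆ ballFin X τ Rw ×ˢ box 2 (25 * C.r) →
      A' ⊆ D' → (∀ v ∈ A', v.1 ∈ ballFin X τ (ρ + 1)) → (bondPercolation (X □ zdGraph 2) q).real (excess X τ R' D' A') ≤ η)
    (hgap : ∀ ρ, 2 * L' + R₁ ρ ≤ gap ρ)
    {δA : ℝ} (hδA : 0 < δA) (hδA1 : δA ≤ 1)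
    (hstdA : ∀ τ ∈ V₀,
      1 - δA ^ 2 < (bondPercolation (X □ zdGraph 2) q).real (UniqZone.zone (X □ zdGraph 2) (ufatSeq X hT V₀ τ) (msel τ) M) ∧
      ∀ g : HOct 2, 1 - δA ^ 2 < (bondPercolation (X □ zdGraph 2) q).real
        (linkIn (↑(ufatSeq X hT V₀ τ M)) (ufatSeq X hT V₀ τ (msel τ)) (ballFin X τ (ufatRadius X hT V₀ M) ×ˢ piece g M)))
    {ℓ₀ ℓ₁A : ℕ} (hMℓ : M < ℓ₀)
    (hlinkA : ∀ ℓ, ℓ₀ ≤ ℓ → ℓ ≤ ℓ₁A → ∀ τ ∈ V₀, ∀ g : HOct 2, 1 - δA ^ 2 < (bondPercolation (X □ zdGraph 2) q).real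
      (linkIn (↑(ufatSeq X hT V₀ τ ℓ)) (ufatSeq X hT V₀ τ (msel τ)) (ballFin X τ (ufatRadius X hT V₀ ℓ) ×ˢ piece g ℓ)))
    {nmax : ℕ}
    (hchainA : ∀ n, n ≤ nmax → ∀ (π : Finset W) (Wg : Sym2 (W × Site 2) → unitInterval) (s : Fin (n + 1) → TStep (tubeGraph X π))
      (T' : Fin (n + 1) → Finset (W × Site 2)) (η : ℝ),
      (∀ i, (s i).L.o = (s 0).L.o) → (∀ i : Fin n, T' (Fin.castSucc i) ⊆ (s i.succ).L.X 0) → (∀ i, T' i ⊆ (s i).T) →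
      (∀ i, (s i).KitsAt Wg q Δ' δA) → η ≤ δA / 2 →
      (∀ i, (prodBernoulli Wg).real (⋃ t ∈ (s i).T \ T' i, openConn (s 0).L.o t) ≤ η) →
      1 - δA < (prodBernoulli Wg).real (s 0).L.reachB →
        1 - δ₂ ^ 2 < (prodBernoulli Wg).real (⋃ t ∈ T' (Fin.last n), openConn (s 0).L.o t))
    {L'A s₁ R'A RlevA kkA N_A ℓ1 : ℕ}
    (hLψA : ufatRadius X hT V₀ ℓ₁A + ufatRadius X hT V₀ M ≤ L'A) (hLRA : L'A ≤ L_A) (hRlA : RlevA + 1 ≤ R'A)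
    (hs : R'A + ℓ₀ ≤ s₁) (hs2 : 2 * R'A ≤ s₁) (hℓ1 : M + s₁ + 2 * R'A + 1 ≤ ℓ1) (hℓ1A : ℓ1 ≤ ℓ₁A) (hsA : s₁ + R'A ≤ ℓ₁A)
    (hn : 12 * C.r ≤ nmax * s₁) (hbig : Rlev + ℓ1 + 2 * s₁ + (nmax + 3) * R'A ≤ C.r) (h10s : Rlev + ℓ1 + 1 ≤ 10 * C.s)
    (hNA : kkA * kitB Δ M (ufatRadius X hT V₀ M) ≤ N_A) (hkkA : (1 - (q : ℝ) ^ kitSB Δ M (ufatRadius X hT V₀ M)) ^ kkA ≤ δA)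
    (hcountA : 1 / (1 - (q : ℝ)) ^ (Δ' * N_A) ≤ δA * ((Finset.Icc (M + 1) RlevA).card : ℝ))
    {ηA : ℝ} (hηA : ηA ≤ δA / 2) {R₀A R₁A : ℕ} (hR₀A : ufatRadius X hT V₀ M ≤ R₀A)
    (hR₁A : ∀ R'', R₁A ≤ R'' → ∀ τ ∈ V₀, ∀ (Rw : ℕ) (D' A' : Finset (W × Site 2)), D' ⊆ ballFin X τ Rw ×ˢ box 2 (25 * C.r) → A' ⊆ D' →
      (∀ a ∈ A', a.1 ∈ ballFin X τ R₀A) → (bondPercolation (X □ zdGraph 2) q).real (excess X τ R'' D' A') ≤ ηA)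
    (hR₁LA : R₁A ≤ L_A - L'A) :
    KSchA.FaceOblR X (concSchemeG X C w₀ (concRadiiGB C gap gap' E₀ L') q δc) (faceDataCG X C w₀ (concRadiiGB C gap gap' E₀ L')) Δ' δ₂ :=
  KSchA.faceOblR_of_faceOblC (faceOblC_concGB' X C w₀ gap gap' E₀ L' hΔ hT V₀ hfr hδ₂ hmsel hstd hψ hL hMR hRlev hRlev' hN hk hcount hη R₁ hR₁
    hgap hδA hδA1 hstdA hMℓ hlinkA hchainA hLψA hLRA hRlA hs hs2 hℓ1 hℓ1A hsA hn hbig h10s hNA hkkA hcountA hηA hR₀A hR₁A hR₁LA)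

end BoxProdZ2

end Transplant

end Summit.CriticalPhenomena.PercolationContinuityZ3.Theorems

end
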